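import Mathlib
import Summits.ResolutionOfSingularities.ResolutionOfSingularities.Theses.AbhyankarShadows
import Summits.ResolutionOfSingularities.ResolutionOfSingularities.Theorems.ShadowsUniformize.Negative.IdentityShadow
import Summits.ResolutionOfSingularities.ResolutionOfSingularities.Theorems.AbhyankarShadowsSemivaluationShadowsQfgRankOne
import Summits.ResolutionOfSingularities.ResolutionOfSingularities.Theorems.AbhyankarShadowsSemivaluationShadowsArcShadow
import Summits.ResolutionOfSingularities.ResolutionOfSingularities.Theorems.AbhyankarShadowsSemivaluationShadowsQfgHigherRank
import Summits.ResolutionOfSingularities.ResolutionOfSingularities.Theorems.AbhyankarShadowsSemivaluationShadowsRuledShadowsRankOne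
import Summits.ResolutionOfSingularities.ResolutionOfSingularities.Theorems.AbhyankarShadowsSemivaluationShadowsRuledOverAbhyankarBaseShadows
import Literature.AlgebraicGeometry.Resolution.TranscendenceDefect
import Literature.AlgebraicGeometry.Resolution.PrimeDivisors
import HarnessLib

/-!
# Crux `SemivaluationShadows` (stmt-ResolutionOfSingularities-16757) — line `birth`, skeleton v2 (lead reshape 1)

Route `ResolutionOfSingularities/AbhyankarShadows`, crux #3 (rank 3, difficulty open-problem):
`SemivaluationShadows` = the EXISTENCE half of Teissier's semivaluation conjecture typed over finite
sets: for `k` algebraically closed of characteristic `p`, `K/k` finitely generated, `O` a RATIONAL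
valuation ring of `K` over `k` and `R ⊆ O` finitely generated, every finite `F ⊆ R` admits a SHADOW of
`(R, O)` exact on `F` (`HasShadow O R F` below = the ∃-tail of the crux verbatim).

## v2/v3 cut (lead, 2026-08-17): identity seam + stubs, composition `SemivaluationShadows_of` PROVED

v3/v4/v5 add `stub_ruledShadowsRankOne`, `stub_henselOverRuledShadowsRankOne` (rank one) and
`stub_ruledOverAbhyankarBaseShadows` (higher rank) (the RULED case in rational rank one — `K = K₀(y)`, `ν|K₀` discrete —
provable by the lead's minimal-approximant engine, CORE.md §1) in front of the rank-one core, whose hypotheses now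
exclude the ruled presentations.

The composition first asks whether some local blowing up `R ≤ R₁ ⊆ O` has a finitely generated value
semigroup (a QFG model): if so the IDENTITY shadow on it is exact on all of `R` (`identityShadow`,
proved; the refuter's route-review observation). Otherwise:

* `O` is not Abhyankar — `stub_qfgRankOne` + `stub_qfgHigherRank` (KNOWN: Abhyankar ⇒ QFG, split
  by the rank of the value group (archimedean or not); Teissier 2014 Thm 6.21 / Cor 6.22,
  Knaf–Kuhlmann 2005 Thm 1.1 + Perron; the tree has the very-good-chart / Perron-dominant-term
  machinery of the `Valuative` route, `Theorems.PfaffLine.*`: `exists_chart_top` /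
  `ap_flag_chart_top`, `stub_perronDominantTerm`, `ap_adaptedPerron_flag`), combined by the proved
  `quasiFiniteGeneration_of`;
* the value group of `O` is not cyclic — at a DISCRETE rational place every model is QFG-free of
  charge and the identity shadow serves; this is LANDED and imported
  (`Theorems.ShadowsUniformize.Negative.hasShadows_of_isCyclic_valueGroup`, Mathlib
  `Nat.addSubmonoid_fg`), so the composition calls it directly;
* hence the rational rank `r = Module.finrank ℤ (Additive Γˣ)` is `≥ 1` (`one_le_finrank_valueGroup`,
  proved here from the tree's `one_le_ratRank_of_ne_top` and Abhyankar's inequality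
  `ratRank_lt_aleph0`), and the composition splits on `r = 1` / `r ≥ 2`:
  - `r = 1`: by the standing Disproof's analysis R2 (`Cruxes/SemivaluationShadows/Disproof.lean`) a
    shadow of rational rank one is the same thing as a FORMAL ARC through the centre with the right
    orders on `F`; the skeleton therefore routes through `stub_exactArcs` (the OPEN core in rational
    rank one, in arc form: a model `R₁`, an arc `α : R₁ →ₐ[k] k⟦t⟧` centred at the centre of `O`, a
    scale `γ₀ ∈ Γ`, `0 < γ₀ < 1`, with `γ₀ ^ ord α(y) ∈ ν(R₁)` and `γ₀ ^ ord α(x) = ν(x)` on `F`) and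
    the TRANSFER `stub_arcShadow` (provable now: `L = k((t))`, `O' = k⟦t⟧`, `φ = α`,
    `ι(t-adic unit class ^ n) = γ₀ ^ n`; numerical semigroups are finitely generated). The surface case
    of the v1 cut (`trdeg ≤ 2`, Spivakovsky 1990 §8 / Favre–Jonsson 2004: key-polynomial curve
    semivaluations) is the `trdeg = 2` instance of `stub_exactArcs` (its arcs are the branches
    `Q_i = 0`).
  - `r ≥ 2`: `stub_higherRankShadows` (the OPEN core in rational rank ≥ 2, non-Abhyankar, off the
    QFG locus; known sub-case in print: `trdeg ≤ 3` via CossartPiltant2019 + CJS embedded resolution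
    + the monomial Hahn shadow `u_i ↦ t^{ν(u_i)}` into `k((t^Γ'))`, cf. refuter CRUX-ATTACK-16757).

Every stub is used; none is the crux (each carries hypotheses the crux does not grant — `¬` QFG
model, transcendence defect `≠ 0`, a rank condition — or has a different conclusion); none is the
summit. v1's `stub_surfaceLimitShadows` and `stub_limitShadows` are SUPERSEDED (absorbed into
`stub_exactArcs` / `stub_higherRankShadows` along the rank split instead of the trdeg split).

Disproof used: `Cruxes/SemivaluationShadows/Disproof.lean` (cdisprove cycle 1): R1 = the seam; R2 =
the arc reformulation behind `stub_exactArcs`/`stub_arcShadow`; `_false_without_rational/_fg/_Rfg`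
(landed `Theorems/SemivaluationShadows/Negative/*`) say rationality is used exactly as "the centre on
every model is a closed `k`-point" (the centre clause of `stub_arcShadow`) and finite generation of
`K/k` exactly through the f.g. model `R₁`; R3/R3' (MacLane–Vaquié / ACVF specialisation) and R4 (Hahn
arc pitfalls) are the lead's working notes for the two cores (`Cruxes/SemivaluationShadows/CORE.md`).
-/

noncomputable section

-- single-problem summit: the doubled namespace component `ResolutionOfSingularities` is forced
set_option linter.dupNamespace false

open Literature.AlgebraicGeometry.Resolution (transcendenceDefect ratRank ratRank_lt_aleph0
  trdeg_lt_aleph0_of_fg one_le_ratRank_of_ne_top units_valueGroup_top_eq_one)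
open Summit.ResolutionOfSingularities.ResolutionOfSingularities.Theses.AbhyankarShadows
  (SemivaluationShadows)
open Summit.ResolutionOfSingularities.ResolutionOfSingularities.Theorems.ShadowsUniformize.Negative
  (hasShadows_of_isCyclic_valueGroup)

namespace Summit.ResolutionOfSingularities.ResolutionOfSingularities.Cruxes.SemivaluationShadows.Lines.Birth

/-! ## The shadow predicate (verbatim tail of the crux) and QFG models -/

/-- `HasShadow O R F`: the conclusion of the crux `SemivaluationShadows` for one datum — a finite set
`F` of a finitely generated `k`-subalgebra `R` of `K` inside the valuation ring `O` — copied VERBATIM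
from the route file (`∃ R₁ hle _, R₁.FG ∧ IsFractionRing R₁ K ∧ ∃ L _ _ φ O', …`).
[cite: Teissier2023, p. 5 (Conjecture)] -/
def HasShadow {k K : Type} [Field k] [Field K] [Algebra k K] (O : ValuationSubring K)
    (R : Subalgebra k K) (F : Finset R) : Prop :=
  ∃ (R₁ : Subalgebra k K) (hle : R ≤ R₁) (_ : R₁.toSubring ≤ O.toSubring), R₁.FG ∧
    IsFractionRing R₁ K ∧ ∃ (L : Type) (_ : Field L) (_ : Algebra k L) (φ : R₁ →ₐ[k] L)
    (O' : ValuationSubring L), Module.finrank ℤ (Additive (O'.ValueGroup)ˣ) =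
      Module.finrank ℤ (Additive (O.ValueGroup)ˣ) ∧ (∀ y : R₁, φ y ∈ O') ∧
    (∀ y : R₁, O'.valuation (φ y) < 1 ↔ O.valuation (y : K) < 1) ∧
    (∀ z : L, z ∈ O' → ∃ c : k, O'.valuation (z - algebraMap k L c) < 1) ∧
    (MonoidHom.mrange (O'.valuation.toMonoidWithZeroHom.toMonoidHom.comp
      φ.toRingHom.toMonoidHom)).FG ∧
    ∃ ι : O'.ValueGroup →*₀o O.ValueGroup, Function.Injective ι ∧
      (∀ y : R₁, φ y ≠ 0 → ∃ y' : R₁, ι (O'.valuation (φ y)) = O.valuation (y' : K)) ∧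
      ∀ x ∈ F, ι (O'.valuation (φ (Subalgebra.inclusion hle x))) = O.valuation ((x : R) : K)

/-- `IsQFGModel O R R₁`: `R₁` is a local blowing up of `R` along `O` (`R ≤ R₁ ⊆ O`, finitely
generated, `Frac R₁ = K`) on which the value semigroup `ν(R₁)` (with `0 = ν(0)`, as a submonoid of the
value group with zero) is finitely generated — Teissier's "quasi-finite generation" witnessed by `R₁`.
[cite: Teissier2014, Thm. 6.21 / Cor. 6.22] -/
def IsQFGModel {k K : Type} [Field k] [Field K] [Algebra k K] (O : ValuationSubring K)
    (R R₁ : Subalgebra k K) : Prop :=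
  R ≤ R₁ ∧ R₁.toSubring ≤ O.toSubring ∧ R₁.FG ∧ IsFractionRing R₁ K ∧
    (MonoidHom.mrange (O.valuation.toMonoidWithZeroHom.toMonoidHom.comp
      R₁.val.toRingHom.toMonoidHom)).FG

/-! ## The seam, PROVED: a QFG model carries the identity shadow, exact on all of `R` -/

/-- **Identity shadow.** If `R₁` is a QFG model of `(R, O)` and `O` is rational over `k`, then
`(L, φ, O', ι) = (K, R₁ ↪ K, O, id)` is a shadow of `(R, O)` exact on every finite `F ⊆ R` (indeed on
all of `R₁`). This is the refuter's route-review observation (`IdentityShadow.lean`, item evidence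
2026-08-17), re-proved here as the seam of the skeleton. [folklore] -/
theorem identityShadow {k K : Type} [Field k] [Field K] [Algebra k K] (O : ValuationSubring K)
    (hrat : ∀ x : K, x ∈ O → ∃ c : k, O.valuation (x - algebraMap k K c) < 1)
    (R R₁ : Subalgebra k K) (h : IsQFGModel O R R₁) (F : Finset R) : HasShadow O R F := by
  obtain ⟨hle, h₁O, hfg, hfrac, hsg⟩ := h
  refine ⟨R₁, hle, h₁O, hfg, hfrac, K, inferInstance, inferInstance, R₁.val, O, rfl, ?_, ?_, hrat,
    hsg, OrderMonoidWithZeroHom.id _, fun _ _ hab => hab, ?_, ?_⟩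
  · intro y
    exact h₁O y.2
  · intro y
    exact Iff.rfl
  · intro y _
    exact ⟨y, rfl⟩
  · intro x _
    rfl

/-! ## The stub STATEMENTS by name (`Sig.stub_<name>`; the composition
`SemivaluationShadows_of` takes exactly these as hypotheses) -/

/-- Statement of `stub_qfgRankOne`: over an algebraically closed field of characteristic `p`, a
rational ABHYANKAR valuation ring (`transcendenceDefect = 0`) of a finitely generated `K/k` whose
value group is ARCHIMEDEAN (rank one; stated as in the tree's `stub_perronDominantTerm`:
`∀ z w, ν z < 1 → w ≠ 0 → ∃ N, (ν z)^N < ν w`) admits a QFG model above every finitely generated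
`R ⊆ O`. Route in the tree: rational ⇒ zero-dimensional; `transcendenceDefect = 0` ⇒ Abhyankar place;
very good chart `(R', x)` with `Frac R' = K`, centre `= (x)`, `ℤ`-independent values
(`Theorems.PfaffLine` machinery: `exists_chart_top` / `exists_chart_absorbing`), then
`stub_perronDominantTerm`: every `a ∈ R' ∖ 0` has a dominant monomial, so `ν(R' ∖ 0) = ⊕ ℕ ν(xᵢ)`.
[cite: Teissier2014, Thm. 6.21 / Cor. 6.22; KnafKuhlmann2005, Thm. 1.1] -/
def Sig.stub_qfgRankOne : Prop :=
  ∀ p : ℕ, p.Prime → ∀ (k K : Type) [Field k] [CharP k p] [IsAlgClosed k] [Field K] [Algebra k K],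
    (⊤ : IntermediateField k K).FG → ∀ (O : ValuationSubring K)
    (hk : ∀ c : k, algebraMap k K c ∈ O),
    (∀ x : K, x ∈ O → ∃ c : k, O.valuation (x - algebraMap k K c) < 1) →
    transcendenceDefect k O hk = 0 →
    (∀ z w : K, O.valuation z < 1 → w ≠ 0 → ∃ N : ℕ, O.valuation z ^ N < O.valuation w) →
    ∀ R : Subalgebra k K, R.FG → R.toSubring ≤ O.toSubring → ∃ R₁ : Subalgebra k K, IsQFGModel O R R₁

/-- Statement of `stub_qfgHigherRank`: the same for rational Abhyankar valuation rings whose value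
group is NOT archimedean (rank `≥ 2`; then rational rank `≥ 2`): a QFG model exists above every
finitely generated `R ⊆ O` (Teissier's quasi-finite generation in arbitrary rank; in the tree the
flag-adapted charts `FlagAdaptedChart` / `ap_flag_chart_top` / `ap_adaptedPerron_flag` of the
`Valuative` route replace the archimedean chart). [cite: Teissier2014, Thm. 6.21 / Cor. 6.22;
KnafKuhlmann2005, Thm. 1.1] -/
def Sig.stub_qfgHigherRank : Prop :=
  ∀ p : ℕ, p.Prime → ∀ (k K : Type) [Field k] [CharP k p] [IsAlgClosed k] [Field K] [Algebra k K],
    (⊤ : IntermediateField k K).FG → ∀ (O : ValuationSubring K)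
    (hk : ∀ c : k, algebraMap k K c ∈ O),
    (∀ x : K, x ∈ O → ∃ c : k, O.valuation (x - algebraMap k K c) < 1) →
    transcendenceDefect k O hk = 0 →
    ¬ (∀ z w : K, O.valuation z < 1 → w ≠ 0 → ∃ N : ℕ, O.valuation z ^ N < O.valuation w) →
    ∀ R : Subalgebra k K, R.FG → R.toSubring ≤ O.toSubring → ∃ R₁ : Subalgebra k K, IsQFGModel O R R₁

/-- Statement `Sig.stub_quasiFiniteGeneration` (v1, kept as a DERIVED statement, no longer a stub):
Abhyankar ⇒ QFG in every rank. [cite: Teissier2014, Thm. 6.21 / Cor. 6.22] -/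
def Sig.stub_quasiFiniteGeneration : Prop :=
  ∀ p : ℕ, p.Prime → ∀ (k K : Type) [Field k] [CharP k p] [IsAlgClosed k] [Field K] [Algebra k K],
    (⊤ : IntermediateField k K).FG → ∀ (O : ValuationSubring K)
    (hk : ∀ c : k, algebraMap k K c ∈ O),
    (∀ x : K, x ∈ O → ∃ c : k, O.valuation (x - algebraMap k K c) < 1) →
    transcendenceDefect k O hk = 0 →
    ∀ R : Subalgebra k K, R.FG → R.toSubring ≤ O.toSubring → ∃ R₁ : Subalgebra k K, IsQFGModel O R R₁

/-- `Sig.stub_quasiFiniteGeneration` from its two rank slices (pure logic). [folklore] -/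
theorem quasiFiniteGeneration_of (h₁ : Sig.stub_qfgRankOne) (h₂ : Sig.stub_qfgHigherRank) :
    Sig.stub_quasiFiniteGeneration := by
  intro p hp k K _ _ _ _ _ hfg O hk hrat hD R hR hRO
  by_cases harch : ∀ z w : K, O.valuation z < 1 → w ≠ 0 → ∃ N : ℕ, O.valuation z ^ N < O.valuation w
  · exact h₁ p hp k K hfg O hk hrat hD harch R hR hRO
  · exact h₂ p hp k K hfg O hk hrat hD harch R hR hRO

/-- Statement of `stub_arcShadow` — **the rank-one ARC TRANSFER (provable now).** For a rational
valuation ring `O ∋ k` of `K` of rational rank one (`Module.finrank ℤ (Additive Γˣ) = 1`), a model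
`R ≤ R₁ ⊆ O` (`R₁` f.g., `Frac R₁ = K`), a formal ARC `α : R₁ →ₐ[k] k⟦t⟧` CENTRED at the centre of
`O` (`α y ∈ (t) ↔ ν y < 1`), and a scale `γ₀ ∈ Γ`, `0 < γ₀ < 1`, such that `γ₀ ^ ord α(y)` is a value
of `ν` on `R₁` whenever `α y ≠ 0` and `γ₀ ^ ord α(x) = ν x` for the non-zero `x ∈ F`: then
`HasShadow O R F` — witnessed by `L = k((t))`, `O' = k⟦t⟧` (rational; value group `ℤ`, rational rank
one), `φ = α`, `ι (class of tⁿ) = γ₀ ^ n` (injective ordered since `γ₀ < 1` is not torsion), the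
semigroup of `ord ∘ α` being a numerical semigroup (Mathlib `Nat.addSubmonoid_fg`, tree
`submonoid_fg_of_isCyclic_units`). This is direction ⇐ of the standing Disproof's R2
("rational rank 1 ⇔ arcs"). [folklore] -/
def Sig.stub_arcShadow : Prop :=
  ∀ (k K : Type) [Field k] [Field K] [Algebra k K] (O : ValuationSubring K),
    (∀ c : k, algebraMap k K c ∈ O) →
    (∀ x : K, x ∈ O → ∃ c : k, O.valuation (x - algebraMap k K c) < 1) →
    Module.finrank ℤ (Additive (O.ValueGroup)ˣ) = 1 →
    ∀ (R R₁ : Subalgebra k K) (hle : R ≤ R₁), R₁.toSubring ≤ O.toSubring → R₁.FG →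
    IsFractionRing R₁ K → ∀ (α : R₁ →ₐ[k] PowerSeries k) (γ₀ : O.ValueGroup), 0 < γ₀ → γ₀ < 1 →
    (∀ y : R₁, PowerSeries.constantCoeff (α y) = 0 ↔ O.valuation (y : K) < 1) →
    (∀ y : R₁, α y ≠ 0 → ∃ y' : R₁, γ₀ ^ (α y).order.toNat = O.valuation (y' : K)) →
    ∀ F : Finset R,
    (∀ x ∈ F, ((x : R) : K) ≠ 0 → α (Subalgebra.inclusion hle x) ≠ 0 ∧
        γ₀ ^ (α (Subalgebra.inclusion hle x)).order.toNat = O.valuation ((x : R) : K)) →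
    HasShadow O R F

/-- Statement of `stub_ruledShadowsRankOne` — **the RULED case in rational rank one (provable now; the
lead's minimal-approximant engine).** For `k = k̄` of characteristic `p`, `K/k` finitely generated, `O` rational of
rational rank one, and a presentation `K = K₀(y)` with `y` transcendental over an intermediate field `K₀` on which
`ν` is discrete with uniformiser-like `t` (`ν t < 1`, every value on `K₀^×` a power of `ν t`) — e.g. `K = k(t, y)`,
the plane, or any ruled surface `k(C)(y)` — EVERY finitely generated `R ⊆ O` and finite `F ⊆ R` admit a shadow.
Engine (all landed or registered): extend `ν` to `M = K^a` (`stub_rankOneSaturation`), specialise `y` to an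
approximant `ρ' ∈ M` of MINIMAL DEGREE over `K₀` in the exactness ball (`exists_minimal_exact_specialisation`: exact
on the prescribed finite set AND on every polynomial of smaller degree, so `Γ(K₀(ρ'))` is generated by exact values),
evaluate the model at `y := ρ'` (`stub_evalRationalFunctions`), take as frame a uniformiser of `K₀(ρ')` lifted to an
exact low-degree polynomial in `y`, and transfer (`stub_frameShadow`). [folklore] -/
def Sig.stub_ruledShadowsRankOne : Prop :=
  ∀ p : ℕ, p.Prime → ∀ (k K : Type) [Field k] [CharP k p] [IsAlgClosed k] [Field K] [Algebra k K],
    (⊤ : IntermediateField k K).FG → ∀ (O : ValuationSubring K)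
    (hk : ∀ c : k, algebraMap k K c ∈ O),
    (∀ x : K, x ∈ O → ∃ c : k, O.valuation (x - algebraMap k K c) < 1) →
    Module.finrank ℤ (Additive (O.ValueGroup)ˣ) = 1 →
    ∀ (K₀ : IntermediateField k K) (t y : K), t ∈ K₀ → t ≠ 0 → O.valuation t < 1 →
    (∀ x : K, x ∈ K₀ → x ≠ 0 → ∃ m : ℤ, O.valuation x = O.valuation t ^ m) →
    Transcendental K₀ y → IntermediateField.adjoin K₀ {y} = ⊤ →
    ∀ R : Subalgebra k K, R.FG → R.toSubring ≤ O.toSubring → ∀ F : Finset R, HasShadow O R F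

/-- Statement of `stub_henselOverRuledShadowsRankOne` — **HENSEL-GENERATED top layers over a ruled skeleton, rational
rank one (provable by the lead's engine; wave 5).** As `stub_ruledShadowsRankOne`, but `K = K₀(v)(η)` where `η` is a
HENSEL ROOT over `O ∩ K₀(v)`: `h(η) = 0` for a monic `h` with coefficients in `K₀(v) ∩ O` and `ν(h'(η)) = 1`. This is the
case of every `(K, ν)` of rational rank one whose centre on some model is a REGULAR closed point (local parameters
`(t, v)`, `K₀ = k(t)`; the regular local ring lies in the henselization of `k[t,v]_{(t,v)}`), hence — given resolution
of surfaces — of every `K` of transcendence degree `2` (Spivakovsky's theorem, without generating sequences).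
Engine: specialise `v ↦ ρ'` (minimal approximant), send `η` to the unique root `ζ` of the specialised `h` with residue
`η̄`; the Newton iterates from `η̄ ∈ k` are elements of `K₀(v)` resp. `K₀(ρ')` converging to `η` resp. `ζ` at the SAME
(exactly transported) rate, so every prescribed `q(η)` keeps its value (exactness of `φ` on the finitely many fixed
elements `q(N_m) ∈ K₀(v)`), `Γ(K₀(ρ')(ζ)) = Γ(K₀(ρ'))`, and the frame is again a uniformiser of `K₀(ρ')` lifted by
minimality (tree: `RankOneDensity.exists_newton_step`, `exists_mem_valuation_sub_le_pow`). [folklore] -/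
def Sig.stub_henselOverRuledShadowsRankOne : Prop :=
  ∀ p : ℕ, p.Prime → ∀ (k K : Type) [Field k] [CharP k p] [IsAlgClosed k] [Field K] [Algebra k K],
    (⊤ : IntermediateField k K).FG → ∀ (O : ValuationSubring K)
    (hk : ∀ c : k, algebraMap k K c ∈ O),
    (∀ x : K, x ∈ O → ∃ c : k, O.valuation (x - algebraMap k K c) < 1) →
    Module.finrank ℤ (Additive (O.ValueGroup)ˣ) = 1 →
    ∀ (K₀ : IntermediateField k K) (t v η : K) (h : Polynomial K), t ∈ K₀ → t ≠ 0 → O.valuation t < 1 →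
    (∀ x : K, x ∈ K₀ → x ≠ 0 → ∃ m : ℤ, O.valuation x = O.valuation t ^ m) →
    Transcendental K₀ v →
    (∀ i : ℕ, h.coeff i ∈ IntermediateField.adjoin K₀ {v} ∧ h.coeff i ∈ O) → h.Monic →
    Polynomial.aeval η h = 0 → O.valuation (Polynomial.aeval η (Polynomial.derivative h)) = 1 → η ∈ O →
    IntermediateField.adjoin K₀ {v, η} = ⊤ →
    ∀ R : Subalgebra k K, R.FG → R.toSubring ≤ O.toSubring → ∀ F : Finset R, HasShadow O R F

/-- Statement of `stub_exactArcs` — **the OPEN core in rational rank one, in arc form (Teissier's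
conjecture, existence half, `r = 1`), OFF THE RULED PRESENTATIONS** (v3: the ruled case `K = K₀(y)`, `ν|K₀`
discrete, is `stub_ruledShadowsRankOne`; what is left is the finite top layer of non-ruled `K`, CORE.md §1). For `k = k̄` of characteristic `p`, `K/k` finitely generated,
`O` rational, NOT Abhyankar (`transcendenceDefect ≠ 0`), value group NOT cyclic and of rational rank
one, and `R ⊆ O` f.g. with NO QFG model: every finite `F ⊆ R` is matched by an EXACT ARC — a model
`R ≤ R₁ ⊆ O`, an arc `α : R₁ →ₐ[k] k⟦t⟧` centred at the centre of `O`, a scale `0 < γ₀ < 1` in `Γ`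
with `γ₀ ^ ord α(y) ∈ ν(R₁)` (`α y ≠ 0`) and `γ₀ ^ ord α(x) = ν(x)` for the non-zero `x ∈ F`.
Known sub-cases in print: `trdeg_k K = 2` (Spivakovsky 1990 §8, Favre–Jonsson 2004 Ch. 3: on a
regular model the branches `Q_i = 0` of the MacLane key polynomials of `ν` are such arcs, with
`γ₀ = ν(x)/β̄₀`); `K = K₀(y)` purely transcendental over a subfield carrying the rational rank
(MacLane–Vaquié truncations `[μ; φ_β ↦ ∞]`, Disproof R3); `trdeg ≤ 3` via embedded local
uniformization (CossartPiltant2019 + CJS) and monomial arcs. Open in general (`trdeg ≥ 4`, the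
finite top layer `K/K₀(y)` with `p`-defect: Disproof R3'). [cite: Teissier2023, p. 5 (Conjecture);
Spivakovsky1990, Section 8; Kedlaya2001] -/
def Sig.stub_exactArcs : Prop :=
  ∀ p : ℕ, p.Prime → ∀ (k K : Type) [Field k] [CharP k p] [IsAlgClosed k] [Field K] [Algebra k K],
    (⊤ : IntermediateField k K).FG → ∀ (O : ValuationSubring K)
    (hk : ∀ c : k, algebraMap k K c ∈ O),
    (∀ x : K, x ∈ O → ∃ c : k, O.valuation (x - algebraMap k K c) < 1) →
    transcendenceDefect k O hk ≠ 0 → ¬ IsCyclic (O.ValueGroup)ˣ →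
    Module.finrank ℤ (Additive (O.ValueGroup)ˣ) = 1 →
    ¬ (∃ (K₀ : IntermediateField k K) (t y : K), t ∈ K₀ ∧ t ≠ 0 ∧ O.valuation t < 1 ∧ (∀ x : K, x ∈ K₀ → x ≠ 0 → ∃ m : ℤ, O.valuation x = O.valuation t ^ m) ∧ Transcendental K₀ y ∧ IntermediateField.adjoin K₀ {y} = ⊤) →
    ¬ (∃ (K₀ : IntermediateField k K) (t v η : K) (h : Polynomial K), t ∈ K₀ ∧ t ≠ 0 ∧ O.valuation t < 1 ∧ (∀ x : K, x ∈ K₀ → x ≠ 0 → ∃ m : ℤ, O.valuation x = O.valuation t ^ m) ∧ Transcendental K₀ v ∧ (∀ i : ℕ, h.coeff i ∈ IntermediateField.adjoin K₀ {v} ∧ h.coeff i ∈ O) ∧ h.Monic ∧ Polynomial.aeval η h = 0 ∧ O.valuation (Polynomial.aeval η (Polynomial.derivative h)) = 1 ∧ η ∈ O ∧ IntermediateField.adjoin K₀ {v, η} = ⊤) →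
    ∀ R : Subalgebra k K, R.FG → R.toSubring ≤ O.toSubring →
    (∀ R₁ : Subalgebra k K, ¬ IsQFGModel O R R₁) → ∀ F : Finset R,
    ∃ (R₁ : Subalgebra k K) (hle : R ≤ R₁) (_ : R₁.toSubring ≤ O.toSubring), R₁.FG ∧
      IsFractionRing R₁ K ∧ ∃ (α : R₁ →ₐ[k] PowerSeries k) (γ₀ : O.ValueGroup), 0 < γ₀ ∧ γ₀ < 1 ∧
      (∀ y : R₁, PowerSeries.constantCoeff (α y) = 0 ↔ O.valuation (y : K) < 1) ∧
      (∀ y : R₁, α y ≠ 0 → ∃ y' : R₁, γ₀ ^ (α y).order.toNat = O.valuation (y' : K)) ∧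
      ∀ x ∈ F, ((x : R) : K) ≠ 0 → α (Subalgebra.inclusion hle x) ≠ 0 ∧
        γ₀ ^ (α (Subalgebra.inclusion hle x)).order.toNat = O.valuation ((x : R) : K)

/-- Statement of `stub_ruledOverAbhyankarBaseShadows` — **the RULED case over an ABHYANKAR skeleton, rank-one value
group, any rational rank (provable by the lead's engine; wave 5; a sub-case of the higher-rank core).** `K = K₀(y)` with
`y` transcendental over an intermediate field `K₀` on which `ν` is ABHYANKAR (`transcendenceDefect = 0` for the restricted
valuation ring) and carries the rational rank (values of `K^×` torsion over values of `K₀^×`), the value group of `O`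
ARCHIMEDEAN: every finitely generated `R ⊆ O` and finite `F ⊆ R` admit a shadow. Engine: `stub_baseSaturation`
(`B = K₀ ∖ 0`), minimal approximant `ρ'` (`exists_minimal_exact_specialisation_of_algebra`), `L = K₀(ρ')` Abhyankar
rational of rank one, frame = Perron positive basis of the (finitely generated) value group of `L` realised by exact
low-degree polynomials (tree `exists_basis_lt_one_of_injective`), prescribed-frame chart downstairs (`stub_frameChart`),
transfer (`stub_frameShadow`). [folklore] -/
def Sig.stub_ruledOverAbhyankarBaseShadows : Prop :=
  ∀ p : ℕ, p.Prime → ∀ (k K : Type) [Field k] [CharP k p] [IsAlgClosed k] [Field K] [Algebra k K],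
    (⊤ : IntermediateField k K).FG → ∀ (O : ValuationSubring K)
    (hk : ∀ c : k, algebraMap k K c ∈ O),
    (∀ x : K, x ∈ O → ∃ c : k, O.valuation (x - algebraMap k K c) < 1) →
    transcendenceDefect k O hk ≠ 0 →
    (∀ z w : K, O.valuation z < 1 → w ≠ 0 → ∃ N : ℕ, O.valuation z ^ N < O.valuation w) →
    ∀ (r : ℕ), Module.finrank ℤ (Additive (O.ValueGroup)ˣ) = r →
    ∀ (K₀ : IntermediateField k K) (y : K)
    (hk₀ : ∀ c : k, algebraMap k K₀ c ∈ O.comap (algebraMap K₀ K)), K₀.FG →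
    transcendenceDefect k (O.comap (algebraMap K₀ K)) hk₀ = 0 →
    (∀ z : K, z ≠ 0 → ∃ N : ℕ, N ≠ 0 ∧ ∃ b : K, b ∈ K₀ ∧ b ≠ 0 ∧ O.valuation z ^ N = O.valuation b) →
    Transcendental K₀ y → IntermediateField.adjoin K₀ {y} = ⊤ →
    ∀ R : Subalgebra k K, R.FG → R.toSubring ≤ O.toSubring → ∀ F : Finset R, HasShadow O R F

/-- Statement of `stub_higherRankShadows` — **the OPEN core in rational rank `≥ 2` (Teissier's
conjecture, existence half, `r ≥ 2`), OFF THE RULED-OVER-ABHYANKAR-BASE PRESENTATIONS (v5).** For `k = k̄` of characteristic `p`, `K/k` finitely generated,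
`O` rational, NOT Abhyankar, of rational rank `≥ 2`, and `R ⊆ O` f.g. with NO QFG model: every finite
`F ⊆ R` admits a shadow. Known sub-case in print: `trdeg_k K = 3` (then `r = 2`): embedded local
uniformization (CossartPiltant2019 + Cossart–Jannsen–Saito) makes `F` monomial in a regular system of
parameters `u` at the centre, and `u_i ↦ t^{ν(u_i)}` into the Hahn field `k((t^Γ'))`, `Γ' ⊆ Γ`
finitely generated of full rank, is a shadow (refuter CRUX-ATTACK-16757). Intended engine in general:
specialise the `trdeg − r` transcendentals to an algebraic point of the `K₀`-variety of `K`
(`K₀ = k(g₁,…,g_r)` monomial Abhyankar), exact on `F` by model-completeness of ACVF / pseudo-limits,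
then Knaf–Kuhlmann monomialisation downstairs lifted along Perron monomials; open point: value-group
control of `K₀(θ)` (extra ramification traded for `p`-defect). [cite: Teissier2023, p. 5
(Conjecture); Teissier2014, Section 10] -/
def Sig.stub_higherRankShadows : Prop :=
  ∀ p : ℕ, p.Prime → ∀ (k K : Type) [Field k] [CharP k p] [IsAlgClosed k] [Field K] [Algebra k K],
    (⊤ : IntermediateField k K).FG → ∀ (O : ValuationSubring K)
    (hk : ∀ c : k, algebraMap k K c ∈ O),
    (∀ x : K, x ∈ O → ∃ c : k, O.valuation (x - algebraMap k K c) < 1) →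
    transcendenceDefect k O hk ≠ 0 → 2 ≤ Module.finrank ℤ (Additive (O.ValueGroup)ˣ) →
    ¬ (∃ (K₀ : IntermediateField k K) (y : K) (hk₀ : ∀ c : k, algebraMap k K₀ c ∈ O.comap (algebraMap K₀ K)), K₀.FG ∧ (∀ z w : K, O.valuation z < 1 → w ≠ 0 → ∃ N : ℕ, O.valuation z ^ N < O.valuation w) ∧ transcendenceDefect k (O.comap (algebraMap K₀ K)) hk₀ = 0 ∧ (∀ z : K, z ≠ 0 → ∃ N : ℕ, N ≠ 0 ∧ ∃ b : K, b ∈ K₀ ∧ b ≠ 0 ∧ O.valuation z ^ N = O.valuation b) ∧ Transcendental K₀ y ∧ IntermediateField.adjoin K₀ {y} = ⊤) →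
    ∀ R : Subalgebra k K, R.FG → R.toSubring ≤ O.toSubring →
    (∀ R₁ : Subalgebra k K, ¬ IsQFGModel O R R₁) → ∀ F : Finset R, HasShadow O R F

/-! ## The stubs -/

/-- **LANDED (p167684, `Theorems.qfgRankOne`, worker W-B).** QFG for rational Abhyankar valuation
rings of rank one: very good chart + Perron dominant term (module docstring).
[cite: Teissier2014, Thm. 6.21 / Cor. 6.22; KnafKuhlmann2005, Thm. 1.1] -/
theorem stub_qfgRankOne : Sig.stub_qfgRankOne :=
  fun p hp k K _ _ _ _ _ => Summit.ResolutionOfSingularities.ResolutionOfSingularities.Theorems.qfgRankOne p hp k K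

/-- **LANDED (p168331, `Theorems.qfgHigherRank`, worker W-C; the proof is rank-free).** QFG for
rational Abhyankar valuation rings of higher rank: flag-adapted chart + any-rank dominant monomial
(`PfaffLine.adValue_claimC`) (module docstring).
[cite: Teissier2014, Thm. 6.21 / Cor. 6.22; KnafKuhlmann2005, Thm. 1.1] -/
theorem stub_qfgHigherRank : Sig.stub_qfgHigherRank :=
  fun p hp k K _ _ _ _ _ => Summit.ResolutionOfSingularities.ResolutionOfSingularities.Theorems.qfgHigherRank p hp k K

/-- **LANDED (p167725, `Theorems.arcShadow`, worker W-A).** The rank-one arc transfer: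
`L = k⸨t⸩`, `O' = k⟦t⟧`, `ι (class of tⁿ) = γ₀ ^ n` (module docstring). [folklore] -/
theorem stub_arcShadow : Sig.stub_arcShadow :=
  fun k K _ _ _ => Summit.ResolutionOfSingularities.ResolutionOfSingularities.Theorems.arcShadow k K

/-- **LANDED (p171202, `Theorems.stub_ruledShadowsRankOne` / `ruledShadowsRankOne`, worker W-L; wave 4
assembly of the lead's specialisation engine).** Shadows in the ruled rank-one case (module docstring). [folklore] -/
theorem stub_ruledShadowsRankOne : Sig.stub_ruledShadowsRankOne :=
  Summit.ResolutionOfSingularities.ResolutionOfSingularities.Theorems.stub_ruledShadowsRankOne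

/-- **STUB (provable now; wave 5).** Shadows for Hensel-generated top layers over a ruled skeleton, rank one
(module docstring). [folklore] -/
theorem stub_henselOverRuledShadowsRankOne : Sig.stub_henselOverRuledShadowsRankOne := by
  sorry

/-- **STUB (load-bearing; open-problem).** Exact arcs for rational rank one (module docstring).
[cite: Teissier2023, p. 5 (Conjecture); Spivakovsky1990, Section 8] -/
theorem stub_exactArcs : Sig.stub_exactArcs := by
  sorry

/-- **LANDED (p171548, `Theorems.stub_ruledOverAbhyankarBaseShadows` / `ruledOverAbhyankarBaseShadows_of`, worker W-Q;
helpers p170842, p171015).** Shadows for `K = K₀(y)` ruled over an ABHYANKAR base `K₀` in rank one, any rational rank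
(module docstring). [folklore] -/
theorem stub_ruledOverAbhyankarBaseShadows : Sig.stub_ruledOverAbhyankarBaseShadows :=
  Summit.ResolutionOfSingularities.ResolutionOfSingularities.Theorems.stub_ruledOverAbhyankarBaseShadows

/-- **STUB (load-bearing; open-problem).** Shadows in rational rank `≥ 2` (module docstring).
[cite: Teissier2023, p. 5 (Conjecture); Teissier2014, Section 10] -/
theorem stub_higherRankShadows : Sig.stub_higherRankShadows := by
  sorry

/-! ## The composition (kernel-checked; no `sorry` in its own term) -/

/-- **Rational rank `≥ 1` off the discrete locus.** If the value group of `O ∋ k` (`K/k` finitely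
generated) is not cyclic, then `1 ≤ Module.finrank ℤ (Additive Γˣ)`: `O ≠ ⊤` (the trivial value
group is cyclic), so `1 ≤ ratRank O` (tree `one_le_ratRank_of_ne_top`), and `ratRank O < ℵ₀` by
Abhyankar's inequality (tree `ratRank_lt_aleph0`), so the `finrank` is that natural number.
[folklore] -/
theorem one_le_finrank_valueGroup {k K : Type} [Field k] [Field K] [Algebra k K]
    (hfg : (⊤ : IntermediateField k K).FG) (O : ValuationSubring K)
    (hk : ∀ c : k, algebraMap k K c ∈ O) (hcyc : ¬ IsCyclic (O.ValueGroup)ˣ) :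
    1 ≤ Module.finrank ℤ (Additive (O.ValueGroup)ˣ) := by
  have hO : O ≠ ⊤ := by
    rintro rfl
    haveI : Subsingleton ((⊤ : ValuationSubring K).ValueGroup)ˣ :=
      ⟨fun a b => by rw [units_valueGroup_top_eq_one a, units_valueGroup_top_eq_one b]⟩
    exact hcyc inferInstance
  have h1 : 1 ≤ ratRank O := one_le_ratRank_of_ne_top O hO
  have hlt : ratRank O < Cardinal.aleph0 := ratRank_lt_aleph0 O hk (trdeg_lt_aleph0_of_fg hfg)
  obtain ⟨n, hn⟩ := Cardinal.lt_aleph0.mp hlt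
  have hfin : Module.finrank ℤ (Additive (O.ValueGroup)ˣ) = n :=
    Module.finrank_eq_of_rank_eq (by simpa [ratRank] using hn)
  rw [hfin]
  rw [hn] at h1
  exact_mod_cast h1

/-- **`SemivaluationShadows` from the ruled stub and the two OPEN core statements** (the three landed stubs
`stub_qfgRankOne`, `stub_qfgHigherRank`, `stub_arcShadow` are used as theorems) — the assembly,
PROVED: for a datum
`(p, k, K, O, R, F)` of the crux, either some local blowing up of `R` along `O` is a QFG model, and
the identity shadow on it is exact on `F` (`identityShadow`); or there is none, in which case `O` is
not Abhyankar (QFG stubs, contrapositive) and not discrete (landed `hasShadows_of_isCyclic_valueGroup`,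
used directly), so its rational rank is `1` — exact arcs (`stub_exactArcs`) transferred by
`stub_arcShadow` — or `≥ 2` (`stub_higherRankShadows`). [cite: Teissier2023, p. 5] -/
theorem SemivaluationShadows_of :
    Sig.stub_henselOverRuledShadowsRankOne → Sig.stub_exactArcs → Sig.stub_higherRankShadows →
      SemivaluationShadows := by
  intro hHe hE hH p hp k K _ _ _ _ _ hfg O hk hrat R hR hRO F
  have hRu : Sig.stub_ruledShadowsRankOne := stub_ruledShadowsRankOne
  have hRA : Sig.stub_ruledOverAbhyankarBaseShadows := stub_ruledOverAbhyankarBaseShadows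
  have hQ : Sig.stub_quasiFiniteGeneration :=
    quasiFiniteGeneration_of stub_qfgRankOne stub_qfgHigherRank
  have hA : Sig.stub_arcShadow := stub_arcShadow
  show HasShadow O R F
  by_cases hq : ∃ R₁ : Subalgebra k K, IsQFGModel O R R₁
  · obtain ⟨R₁, h₁⟩ := hq
    exact identityShadow O hrat R R₁ h₁ F
  · have hnq : ∀ R₁ : Subalgebra k K, ¬ IsQFGModel O R R₁ := fun R₁ h₁ => hq ⟨R₁, h₁⟩
    have hD : transcendenceDefect k O hk ≠ 0 := fun hD => hq (hQ p hp k K hfg O hk hrat hD R hR hRO)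
    by_cases hcyc : IsCyclic (O.ValueGroup)ˣ
    · exact hasShadows_of_isCyclic_valueGroup hfg O hk hrat hcyc R hR hRO F
    · have h1 := one_le_finrank_valueGroup hfg O hk hcyc
      rcases h1.eq_or_lt with h1 | h2
      · by_cases hruled : (∃ (K₀ : IntermediateField k K) (t y : K), t ∈ K₀ ∧ t ≠ 0 ∧ O.valuation t < 1 ∧ (∀ x : K, x ∈ K₀ → x ≠ 0 → ∃ m : ℤ, O.valuation x = O.valuation t ^ m) ∧ Transcendental K₀ y ∧ IntermediateField.adjoin K₀ {y} = ⊤)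
        · obtain ⟨K₀, t, y, htK₀, ht0, ht1, hdisc, hy, hgen⟩ := hruled
          exact hRu p hp k K hfg O hk hrat h1.symm K₀ t y htK₀ ht0 ht1 hdisc hy hgen R hR hRO F
        · by_cases hhensel : (∃ (K₀ : IntermediateField k K) (t v η : K) (h : Polynomial K), t ∈ K₀ ∧ t ≠ 0 ∧ O.valuation t < 1 ∧ (∀ x : K, x ∈ K₀ → x ≠ 0 → ∃ m : ℤ, O.valuation x = O.valuation t ^ m) ∧ Transcendental K₀ v ∧ (∀ i : ℕ, h.coeff i ∈ IntermediateField.adjoin K₀ {v} ∧ h.coeff i ∈ O) ∧ h.Monic ∧ Polynomial.aeval η h = 0 ∧ O.valuation (Polynomial.aeval η (Polynomial.derivative h)) = 1 ∧ η ∈ O ∧ IntermediateField.adjoin K₀ {v, η} = ⊤)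
          · obtain ⟨K₀, t, v, η, h, htK₀, ht0, ht1, hdisc, hv, hcoef, hmon, hroot, hder, hηO, hgen⟩ := hhensel
            exact hHe p hp k K hfg O hk hrat h1.symm K₀ t v η h htK₀ ht0 ht1 hdisc hv hcoef hmon hroot hder hηO
              hgen R hR hRO F
          · obtain ⟨R₁, hle, h₁O, hfg₁, hfrac, α, γ₀, hγ₀, hγ₁, hcen, h6b, hex⟩ :=
              hE p hp k K hfg O hk hrat hD hcyc h1.symm hruled hhensel R hR hRO hnq F
            exact hA k K O hk hrat h1.symm R R₁ hle h₁O hfg₁ hfrac α γ₀ hγ₀ hγ₁ hcen h6b F hex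
      · by_cases hrab : (∃ (K₀ : IntermediateField k K) (y : K) (hk₀ : ∀ c : k, algebraMap k K₀ c ∈ O.comap (algebraMap K₀ K)), K₀.FG ∧ (∀ z w : K, O.valuation z < 1 → w ≠ 0 → ∃ N : ℕ, O.valuation z ^ N < O.valuation w) ∧ transcendenceDefect k (O.comap (algebraMap K₀ K)) hk₀ = 0 ∧ (∀ z : K, z ≠ 0 → ∃ N : ℕ, N ≠ 0 ∧ ∃ b : K, b ∈ K₀ ∧ b ≠ 0 ∧ O.valuation z ^ N = O.valuation b) ∧ Transcendental K₀ y ∧ IntermediateField.adjoin K₀ {y} = ⊤)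
        · obtain ⟨K₀, y, hk₀, hK₀, hr1, hD₀, htors, hy, hgen⟩ := hrab
          exact hRA p hp k K hfg O hk hrat hD hr1 _ rfl K₀ y hk₀ hK₀ hD₀ htors hy hgen R hR hRO F
        · exact hH p hp k K hfg O hk hrat hD h2 hrab R hR hRO hnq F

/-- **The crux `SemivaluationShadows`, assembled from the registered stubs** (the skeleton in
its final shape: `SemivaluationShadows_of` with the `stub_*` plugged in; the only `sorry`s in its
closure are the stubs, none of its own). -/
theorem SemivaluationShadows_proof : SemivaluationShadows :=
  SemivaluationShadows_of stub_henselOverRuledShadowsRankOne stub_exactArcs stub_higherRankShadows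

end Summit.ResolutionOfSingularities.ResolutionOfSingularities.Cruxes.SemivaluationShadows.Lines.Birth

end
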